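import Mathlib.Analysis.SpecialFunctions.Sqrt
import Literature.Topology.FourManifolds.ConcordanceStraightening
import Literature.Topology.FourManifolds.SliceGenusConcordance
import Literature.Topology.FourManifolds.SliceRibbonConcordanceProofs
import HarnessLib

/-!
# Transitivity of knot concordance: discharge of `equivalence_isConcordant`

Topic `Literature/Topology/FourManifolds` (trunk T-4MAN). This file **discharges** the named fact
`Literature.Topology.FourManifolds.equivalence_isConcordant` of `SliceRibbon.lean` — *smooth
concordance of knots (`Literature.Topology.FourManifolds.Knot.IsConcordant`: a neat annulus
`𝕊 1 × [1, 2] ↪ {1 ≤ ‖y‖ ≤ 2} ⊂ ℝ⁴` from `K` to `2 • K'`) is an equivalence relation*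
(Fox–Milnor (1966), §1; Livingston (2005), Thm. 2.1) — as
`Literature.Topology.FourManifolds.equivalence_isConcordant_holds`. Reflexivity
(`Knot.IsConcordant.refl'`, `SliceRibbonConcordanceProofs.lean`) and symmetry
(`Knot.IsConcordant.swap`, `SliceGenusConcordance.lean`) are in the tree; proved here is
**transitivity** (`Literature.Topology.FourManifolds.Knot.IsConcordant.trans'`), by the textbook
stacking argument made explicit for the tree's parametrised annuli:

1. `Literature.Topology.FourManifolds.Knot.IsConcordance.shellReflect`, `….reflect`,
   `….reflect_isConcordance` — the **radial reflection** `r • u ↦ (3 - r) • u` of the shell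
   composed with the time flip `t ↦ 3 - t` turns a concordance from `K` to `K'` into one from
   `K'` to `K` (a second proof of symmetry, next to the inversion `2 y / ‖y‖²` used by
   `IsConcordance.reverse`); its point is `….reflect_cone`: it carries the inner cone
   `s • K x`, `s ∈ [1, 1 + δ]`, to the outer cone `t • K x`, `t ∈ [2 - δ, 2]`, which the
   inversion does not.
2. `….exists_isConcordance_radial_outer` — **straightening near the outer end**: every
   concordance from `K` to `K'` can be replaced by one equal to the cone `t • K' x` for
   `t ∈ [2 - δ, 2]` (reverse, straighten the inner end by
   `Knot.Straightening.exists_isConcordance_radial` of `ConcordanceStraightening.lean` — Kosinski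
   (1993), II (2.8.2): a neat submanifold is vertical in a suitable collar — and reflect).
3. `….stack`, `….contMDiff_stack`, `….stack_injOn`, `….injective_mfderiv_stack` — **stacking**:
   for `F` from `K` to `K'` straight near its outer end and `G` from `K'` to `K''` straight near
   its inner end, `F` on radii `[1, 2]` followed by `2 • G (x, r / 2)` on radii `[2, 4]` is a
   smooth neat embedded annulus from `K` to `4 • K''` in the doubled shell: both pieces are the
   cone `r • K' x` on the strip `|r - 2| < δ`, so smoothness, injectivity and the immersion
   property are checked on the open cover `{r < 2} ∪ {|r - 2| < δ} ∪ {r > 2}` (the cone is an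
   immersion by `Knot.isConcordance_coneMap_self`).
4. `….shellCompress` (`r • u ↦ ((r + 2) / 3) • u`, with the explicit inverse `….shellExpand`),
   `….triple` (`s ↦ 3 s - 2`), `….compose`, `….isConcordance_compose` — re-timing `[1, 2] → [1, 4]`
   and compressing the radii `[1, 4] → [1, 2]` affinely gives a concordance from `K` to `K''` in
   the sense of `Knot.IsConcordance` (neatness at the ends follows from that of `F` at `t = 1`
   and of `G` at `t = 2` by the chain rule).

All radial maps are cut off near the origin with `Knot.IsConcordance.invCutoff`
(`SliceGenusConcordance.lean`) so as to be `C^∞` on all of `ℝ⁴` (`….contDiff_comp_norm`), as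
`Knot.IsConcordance.shellInversion` is.

## References

* R. H. Fox, J. W. Milnor, *Singularities of 2-spheres in 4-space and cobordism of knots*,
  Osaka J. Math. 3 (1966), 257–267, §1 (knot cobordism is an equivalence relation; the
  cobordism classes form an abelian group under `#`). [FoxMilnor1966]
* C. Livingston, *A survey of classical knot concordance*, in: Handbook of Knot Theory (2005),
  §2.1, Thm. 2.1–2.2 (held: arXiv math/0307077, p. 3). [Livingston2005]
* A. A. Kosinski, *Differential Manifolds* (1993), II (2.8.2). [Kosinski1993]

## Design notes

* No statement of another file is modified; the file declares no named facts and uses no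
  `sorry`. The `def`s (`shellReflect`, `reflect`, `shellCompress`, `shellExpand`, `half`,
  `triple`, `stack`, `compose`) are the auxiliary constructions of the proof, kept in the
  namespace `Literature.Topology.FourManifolds.Knot.IsConcordance` next to `reverse`,
  `timeFlip`, `shellInversion`.
* Consumers: `Knot.IsConcordant.trans`, `ConcordanceClass.mk_eq_mk_iff` (`SliceRibbon.lean`) and
  the reduction `Knot.IsConnectedSum.isConcordant_of_exists` (`BandSumConcordance.lean`) of the
  Fox–Milnor congruence `Knot.IsConnectedSum.isConcordant` take `equivalence_isConcordant` as a
  hypothesis, now fed `equivalence_isConcordant_holds`.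
* Notation `𝔼 n`, `𝕊 n` is local, byte-identical to `SliceRibbon.lean`.
-/

open scoped Manifold ContDiff Topology
open Function Set

noncomputable section

namespace Literature.Topology.FourManifolds

/-- Local notation: `𝔼 n` is the model Euclidean space `EuclideanSpace ℝ (Fin n)`. -/
local notation "𝔼 " n:arg => EuclideanSpace ℝ (Fin n)

/-- Local notation: `𝕊 n` is the unit sphere in `EuclideanSpace ℝ (Fin (n + 1))`. -/
local notation "𝕊 " n:arg => (Metric.sphere (0 : EuclideanSpace ℝ (Fin (n + 1))) 1)

namespace Knot

namespace IsConcordance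

/-! ### Smooth radial maps of `ℝ⁴` -/

/-- A `C^∞` function of the norm which vanishes for small arguments is `C^∞` on `ℝ⁴` (near the
origin it is identically zero, elsewhere the norm is smooth). [folklore] -/
theorem contDiff_comp_norm {g : ℝ → ℝ} (hg : ContDiff ℝ ∞ g) (h0 : ∀ s ≤ 1 / 8, g s = 0) :
    ContDiff ℝ ∞ fun y : 𝔼 4 ↦ g ‖y‖ := by
  rw [contDiff_iff_contDiffAt]
  intro y
  by_cases hy : y = 0
  · have hev : (fun z : 𝔼 4 ↦ g ‖z‖) =ᶠ[𝓝 y] fun _ ↦ 0 := by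
      have hB : Metric.ball (0 : 𝔼 4) (1 / 8) ∈ 𝓝 y := by
        subst hy
        exact Metric.ball_mem_nhds _ (by norm_num)
      filter_upwards [hB] with z hz
      exact h0 _ (le_of_lt (mem_ball_zero_iff.1 hz))
    exact contDiffAt_const.congr_of_eventuallyEq hev
  · exact hg.contDiffAt.comp y (contDiffAt_norm ℝ hy)

/-- `y ↦ invCutoff ‖y‖` (`= 1 / ‖y‖` for `‖y‖ ≥ 1/4`, `= 0` near the origin) is `C^∞` on `ℝ⁴`.
[folklore] -/
theorem contDiff_invCutoff_norm : ContDiff ℝ ∞ fun y : 𝔼 4 ↦ invCutoff ‖y‖ :=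
  contDiff_comp_norm contDiff_invCutoff fun _ hs ↦ invCutoff_eq_zero hs

/-! ### The radial reflection of the shell -/

/-- The **radial reflection of the shell** `{1 ≤ ‖y‖ ≤ 2} ⊂ ℝ⁴` in the sphere of radius `3/2`,
`y ↦ (3 / ‖y‖ - 1) • y`, i.e. `r • u ↦ (3 - r) • u` for unit vectors `u` (cut off near the
origin so as to be `C^∞` on all of `ℝ⁴`). It swaps the spheres of radius `1` and `2`, is an
involution on `{1/4 ≤ ‖y‖ ≤ 11/4}`, and — unlike the inversion `shellInversion` — carries the
cone `s • u`, `s ∈ [1, 1 + δ]`, onto the cone `t • u`, `t ∈ [2 - δ, 2]`, which is what transports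
the inner-end normal form of a concordance (`Straightening.exists_isConcordance_radial`) to the
outer end (`exists_isConcordance_radial_outer`). [folklore] -/
def shellReflect (y : 𝔼 4) : 𝔼 4 :=
  (3 * invCutoff ‖y‖ - 1) • y

/-- `shellReflect` is `C^∞` on `ℝ⁴`. [folklore] -/
theorem contDiff_shellReflect : ContDiff ℝ ∞ shellReflect :=
  ((contDiff_const.mul contDiff_invCutoff_norm).sub contDiff_const).smul contDiff_id

/-- Away from the cut-off, `shellReflect y = (3 / ‖y‖ - 1) • y`. [folklore] -/
theorem shellReflect_eq {y : 𝔼 4} (hy : 1 / 4 ≤ ‖y‖) :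
    shellReflect y = (3 * ‖y‖⁻¹ - 1) • y := by
  unfold shellReflect
  rw [invCutoff_eq_inv hy]

/-- `shellReflect (t • u) = (3 - t) • u` for a unit vector `u` and `t ≥ 1/4`. [folklore] -/
theorem shellReflect_smul {u : 𝔼 4} (hu : ‖u‖ = 1) {t : ℝ} (ht : 1 / 4 ≤ t) :
    shellReflect (t • u) = (3 - t) • u := by
  have ht0 : t ≠ 0 := by positivity
  have hn : ‖t • u‖ = t := by rw [norm_smul, hu, mul_one, Real.norm_of_nonneg (by positivity)]
  rw [shellReflect_eq (by rw [hn]; exact ht), hn, smul_smul]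
  congr 1
  field_simp

/-- `‖shellReflect y‖ = 3 - ‖y‖` for `1/4 ≤ ‖y‖ ≤ 3`. [folklore] -/
theorem norm_shellReflect {y : 𝔼 4} (hy : 1 / 4 ≤ ‖y‖) (hy' : ‖y‖ ≤ 3) :
    ‖shellReflect y‖ = 3 - ‖y‖ := by
  have hy0 : 0 < ‖y‖ := by linarith
  have hc : 0 ≤ 3 * ‖y‖⁻¹ - 1 := by
    rw [sub_nonneg, le_mul_inv_iff₀ hy0]
    linarith
  rw [shellReflect_eq hy, norm_smul, Real.norm_of_nonneg hc, sub_mul, mul_assoc,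
    inv_mul_cancel₀ hy0.ne', mul_one, one_mul]

/-- `shellReflect` is an involution on the thick shell `1/4 ≤ ‖y‖ ≤ 11/4`. [folklore] -/
theorem shellReflect_shellReflect {y : 𝔼 4} (hy : 1 / 4 ≤ ‖y‖) (hy' : ‖y‖ ≤ 11 / 4) :
    shellReflect (shellReflect y) = y := by
  have hy0 : 0 < ‖y‖ := by linarith
  have h1 : 1 / 4 ≤ ‖shellReflect y‖ := by
    rw [norm_shellReflect hy (by linarith)]
    linarith
  have h3 : (3 : ℝ) - ‖y‖ ≠ 0 := by linarith
  rw [shellReflect_eq h1, norm_shellReflect hy (by linarith), shellReflect_eq hy, smul_smul]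
  conv_rhs => rw [← one_smul ℝ y]
  congr 1
  field_simp
  ring

/-- The derivative of `shellReflect` at a point of the shell `1 ≤ ‖y‖ ≤ 2` is injective (chain
rule applied to `shellReflect ∘ shellReflect = id` near `y`). [folklore] -/
theorem fderiv_shellReflect_injective {y : 𝔼 4} (hy : 1 ≤ ‖y‖) (hy' : ‖y‖ ≤ 2) :
    Injective (fderiv ℝ shellReflect y) := by
  have hev : shellReflect ∘ shellReflect =ᶠ[𝓝 y] id := by
    have hU : {z : 𝔼 4 | 1 / 2 < ‖z‖ ∧ ‖z‖ < 5 / 2} ∈ 𝓝 y :=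
      ((isOpen_lt continuous_const continuous_norm).inter
        (isOpen_lt continuous_norm continuous_const)).mem_nhds
          (show 1 / 2 < ‖y‖ ∧ ‖y‖ < 5 / 2 from ⟨by linarith, by linarith⟩)
    filter_upwards [hU] with z hz using shellReflect_shellReflect (by linarith [hz.1])
      (by linarith [hz.2])
  have hd : ∀ z, DifferentiableAt ℝ shellReflect z := fun z ↦
    contDiff_shellReflect.contDiffAt.differentiableAt (by simp)
  have key : (fderiv ℝ shellReflect (shellReflect y)).comp (fderiv ℝ shellReflect y) =
      ContinuousLinearMap.id ℝ (𝔼 4) := by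
    rw [← fderiv_comp y (hd _) (hd y), hev.fderiv_eq, fderiv_id]
  intro v w h
  have h' := congrArg (fderiv ℝ shellReflect (shellReflect y)) h
  rwa [← ContinuousLinearMap.comp_apply, ← ContinuousLinearMap.comp_apply, key] at h'

/-! ### Reflecting a concordance -/

/-- The **reflection** of an annulus `f : 𝕊 1 × ℝ → ℝ⁴`: flip time and reflect the shell
radially. For a concordance from `K` to `K'` this is a concordance from `K'` to `K`
(`reflect_isConcordance`) whose outer end is the reflected inner end of `f` (`reflect_cone`).
Fox–Milnor (1966), §1 (symmetry of knot cobordism). [cite: FoxMilnor1966, §1] -/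
def reflect (f : (𝕊 1) × ℝ → 𝔼 4) : (𝕊 1) × ℝ → 𝔼 4 :=
  shellReflect ∘ (f ∘ timeFlip)

/-- Pointwise formula for `reflect`. [folklore] -/
theorem reflect_apply (f : (𝕊 1) × ℝ → 𝔼 4) (x : 𝕊 1) (t : ℝ) :
    reflect f (x, t) = shellReflect (f (x, 3 - t)) := rfl

/-- **The reflection carries an inner cone to an outer cone**: if `f (x, s) = s • K x` for
`s ∈ [1, 1 + δ]`, then `reflect f (x, t) = t • K x` for `t ∈ [2 - δ, 2]`. [folklore] -/
theorem reflect_cone {K : Knot} {f : (𝕊 1) × ℝ → 𝔼 4} {δ : ℝ}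
    (hcone : ∀ x : 𝕊 1, ∀ s ∈ Icc (1 : ℝ) (1 + δ), f (x, s) = s • ((K x : 𝕊 3) : 𝔼 4))
    (x : 𝕊 1) {t : ℝ} (ht : t ∈ Icc (2 - δ) 2) :
    reflect f (x, t) = t • ((K x : 𝕊 3) : 𝔼 4) := by
  have hs : 3 - t ∈ Icc (1 : ℝ) (1 + δ) := ⟨by linarith [ht.2], by linarith [ht.1]⟩
  rw [reflect_apply, hcone x _ hs, shellReflect_smul (norm_eq_of_mem_sphere (K x)) (by linarith [ht.2])]
  congr 1
  ring

/-- **The reflection of a concordance from `K` to `K'` is a concordance from `K'` to `K`.**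
Fox–Milnor (1966), §1 (knot cobordism is symmetric); Livingston (2005), §2.1.
[cite: FoxMilnor1966, §1] -/
theorem reflect_isConcordance {K K' : Knot} {f : (𝕊 1) × ℝ → 𝔼 4} (hf : IsConcordance K K' f) :
    IsConcordance K' K (reflect f) := by
  have hnorm := norm_mem_Icc hf
  obtain ⟨hsmooth, hinj, himm, hshell, hneat, hK, hK'⟩ := hf
  have hflip_mem : ∀ {t : ℝ}, t ∈ Icc (1 : ℝ) 2 → 3 - t ∈ Icc (1 : ℝ) 2 := fun ht ↦
    ⟨by linarith [ht.2], by linarith [ht.1]⟩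
  refine ⟨?_, ?_, ?_, ?_, ?_, ?_, ?_⟩
  · -- smoothness
    exact contDiff_shellReflect.contMDiff.comp (hsmooth.comp contMDiff_timeFlip)
  · -- injectivity on the annulus
    rintro ⟨x, t⟩ ⟨-, ht⟩ ⟨x', t'⟩ ⟨-, ht'⟩ h
    have h1 := hnorm x (hflip_mem ht)
    have h2 := hnorm x' (hflip_mem ht')
    have h' := congrArg shellReflect h
    rw [reflect_apply, reflect_apply, shellReflect_shellReflect (by linarith [h1.1])
      (by linarith [h1.2]), shellReflect_shellReflect (by linarith [h2.1])
      (by linarith [h2.2])] at h'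
    have := hinj ⟨mem_univ _, hflip_mem ht⟩ ⟨mem_univ _, hflip_mem ht'⟩ h'
    simp only [Prod.mk.injEq] at this
    obtain ⟨rfl, htt⟩ := this
    simp only [Prod.mk.injEq, true_and]
    linarith
  · -- immersion on the annulus
    rintro ⟨x, t⟩ ⟨-, ht⟩
    have h1 := hnorm x (hflip_mem ht)
    have hdflip : MDifferentiableAt ((𝓡 1).prod 𝓘(ℝ, ℝ)) ((𝓡 1).prod 𝓘(ℝ, ℝ)) timeFlip (x, t) :=
      contMDiff_timeFlip.mdifferentiableAt (by simp)
    have hdf : MDifferentiableAt ((𝓡 1).prod 𝓘(ℝ, ℝ)) 𝓘(ℝ, 𝔼 4) f (timeFlip (x, t)) :=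
      hsmooth.mdifferentiableAt (by simp)
    have hdS : MDifferentiableAt 𝓘(ℝ, 𝔼 4) 𝓘(ℝ, 𝔼 4) shellReflect ((f ∘ timeFlip) (x, t)) :=
      contDiff_shellReflect.contMDiff.mdifferentiableAt (by simp)
    rw [reflect, mfderiv_comp _ hdS (hdf.comp _ hdflip), mfderiv_comp _ hdf hdflip,
      mfderiv_eq_fderiv]
    exact (fderiv_shellReflect_injective h1.1 h1.2).comp
      ((himm _ ⟨mem_univ _, hflip_mem ht⟩).comp (mfderiv_timeFlip_injective _))
  · -- the open annulus goes into the open shell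
    intro x t ht
    have ht' : 3 - t ∈ Ioo (1 : ℝ) 2 := ⟨by linarith [ht.2], by linarith [ht.1]⟩
    obtain ⟨hl, hu⟩ := hshell x (3 - t) ht'
    rw [reflect_apply, norm_shellReflect (by linarith) (by linarith)]
    exact ⟨by linarith, by linarith⟩
  · -- neatness at both ends
    intro x
    set h : ℝ → ℝ := fun s ↦ ‖f (x, s)‖ ^ 2 with h_def
    have hcurve : ContMDiff 𝓘(ℝ, ℝ) 𝓘(ℝ, 𝔼 4) ∞ fun s : ℝ ↦ f (x, s) :=
      hsmooth.comp (contMDiff_const.prodMk contMDiff_id)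
    have hcurve' : Differentiable ℝ fun s : ℝ ↦ f (x, s) :=
      (contMDiff_iff_contDiff.1 hcurve).differentiable (by simp)
    have hdiff : Differentiable ℝ h := hcurve'.norm_sq ℝ
    have hh : ∀ s, HasDerivAt h (deriv h s) s := fun s ↦ (hdiff s).hasDerivAt
    have hsqrt_eq : ∀ s, Real.sqrt (h s) = ‖f (x, s)‖ := fun s ↦ by
      simp only [h_def]
      exact Real.sqrt_sq (norm_nonneg _)
    -- near `t₀` with `1 ≤ ‖f (x, 3 - t₀)‖ ≤ 2` the radial function of `reflect f` is
    -- `(3 - √(h (3 - t)))²`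
    have hev : ∀ t₀ : ℝ, 1 ≤ ‖f (x, 3 - t₀)‖ → ‖f (x, 3 - t₀)‖ ≤ 2 →
        (fun t ↦ ‖reflect f (x, t)‖ ^ 2) =ᶠ[𝓝 t₀]
          fun t ↦ (3 - Real.sqrt (h (3 - t))) ^ 2 := by
      intro t₀ h1 h2
      have hc : ContinuousAt (fun t : ℝ ↦ ‖f (x, 3 - t)‖) t₀ :=
        ((hcurve'.continuous.comp (continuous_const.sub continuous_id)).norm).continuousAt
      have e1 : ∀ᶠ t in 𝓝 t₀, 1 / 2 < ‖f (x, 3 - t)‖ := hc.eventually (lt_mem_nhds (by linarith))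
      have e2 : ∀ᶠ t in 𝓝 t₀, ‖f (x, 3 - t)‖ < 5 / 2 := hc.eventually (gt_mem_nhds (by linarith))
      filter_upwards [e1, e2] with t ht ht'
      rw [reflect_apply, norm_shellReflect (by linarith) (by linarith), hsqrt_eq]
    have hder : ∀ t₀ : ℝ, 1 ≤ ‖f (x, 3 - t₀)‖ → ‖f (x, 3 - t₀)‖ ≤ 2 →
        HasDerivAt (fun t ↦ ‖reflect f (x, t)‖ ^ 2)
          (((2 : ℕ) : ℝ) * (3 - Real.sqrt (h (3 - t₀))) ^ (2 - 1) *
            (-(deriv h (3 - t₀) * -1 / (2 * Real.sqrt (h (3 - t₀)))))) t₀ := by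
      intro t₀ h1 h2
      have hne : h (3 - t₀) ≠ 0 := by
        simp only [h_def]
        positivity
      have hcomp : HasDerivAt (fun t ↦ h (3 - t)) (deriv h (3 - t₀) * -1) t₀ :=
        (hh (3 - t₀)).comp t₀ ((hasDerivAt_id t₀).const_sub 3)
      have hs := ((hcomp.sqrt hne).const_sub 3).pow 2
      exact hs.congr_of_eventuallyEq (hev t₀ h1 h2)
    have e1 : (3 : ℝ) - 1 = 2 := by norm_num
    have e2 : (3 : ℝ) - 2 = 1 := by norm_num
    have n1 : ‖f (x, 1)‖ = 1 := by rw [hK, norm_eq_of_mem_sphere]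
    have n2 : ‖f (x, 2)‖ = 2 := by rw [hK', norm_smul, norm_eq_of_mem_sphere]; norm_num
    have s1 : Real.sqrt (h 1) = 1 := by rw [hsqrt_eq, n1]
    have s2 : Real.sqrt (h 2) = 2 := by rw [hsqrt_eq, n2]
    obtain ⟨hd1, hd2⟩ := hneat x
    constructor
    · have hd := hder 1 (by rw [e1, n2]; norm_num) (by rw [e1, n2])
      rw [hd.deriv, e1, s2]
      norm_num
      linarith
    · have hd := hder 2 (by rw [e2, n1]) (by rw [e2, n1]; norm_num)
      rw [hd.deriv, e2, s1]
      norm_num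
      linarith
  · -- `reflect f (x, 1) = K' x`
    intro x
    rw [reflect_apply, show (3 : ℝ) - 1 = 2 by norm_num, hK',
      shellReflect_smul (norm_eq_of_mem_sphere (K' x)) (by norm_num)]
    norm_num
  · -- `reflect f (x, 2) = 2 • K x`
    intro x
    rw [reflect_apply, show (3 : ℝ) - 2 = 1 by norm_num, hK, ← one_smul ℝ ((K x : 𝕊 3) : 𝔼 4),
      shellReflect_smul (norm_eq_of_mem_sphere (K x)) (by norm_num)]
    norm_num

/-- **Straightening a concordance near its outer end.** Every concordance from `K` to `K'` can
be replaced by one which is the cone `(x, t) ↦ t • K' x` for `t ∈ [2 - δ, 2]`, some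
`0 < δ ≤ 1`: reverse the concordance (`IsConcordance.reverse`), straighten the inner end of the
reverse (`Straightening.exists_isConcordance_radial`, Kosinski 1993, II (2.8.2)), and reflect
(`reflect_cone`). [cite: Kosinski1993, II (2.8.2)] -/
theorem exists_isConcordance_radial_outer {K K' : Knot} {f : (𝕊 1) × ℝ → 𝔼 4}
    (hf : IsConcordance K K' f) :
    ∃ f₂ : (𝕊 1) × ℝ → 𝔼 4, IsConcordance K K' f₂ ∧ ∃ δ : ℝ, 0 < δ ∧ δ ≤ 1 ∧
      ∀ x : 𝕊 1, ∀ t ∈ Icc (2 - δ) 2, f₂ (x, t) = t • ((K' x : 𝕊 3) : 𝔼 4) := by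
  obtain ⟨g, hg, δ, hδ, hcone⟩ := Straightening.exists_isConcordance_radial hf.reverse_isConcordance
  refine ⟨reflect g, reflect_isConcordance hg, min δ 1, lt_min hδ one_pos, min_le_right _ _,
    fun x t ht ↦ reflect_cone (fun y s hs ↦ hcone y s ?_) x ht⟩
  exact ⟨hs.1, hs.2.trans (by linarith [min_le_left δ 1])⟩

/-! ### Compressing the doubled shell `1 ≤ ‖y‖ ≤ 4` onto the shell `1 ≤ ‖y‖ ≤ 2` -/

/-- The **radial compression** `y ↦ (1/3 + 2 / (3‖y‖)) • y` of `ℝ⁴`, i.e. `r • u ↦ ((r + 2) / 3) • u`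
for unit vectors `u` (cut off near the origin so as to be `C^∞` on all of `ℝ⁴`): an affine
change of the radial coordinate carrying the doubled shell `1 ≤ ‖y‖ ≤ 4` onto the shell
`1 ≤ ‖y‖ ≤ 2`, fixing the unit sphere. [folklore] -/
def shellCompress (y : 𝔼 4) : 𝔼 4 :=
  (3⁻¹ + 2 / 3 * invCutoff ‖y‖) • y

/-- `shellCompress` is `C^∞` on `ℝ⁴`. [folklore] -/
theorem contDiff_shellCompress : ContDiff ℝ ∞ shellCompress :=
  (contDiff_const.add (contDiff_const.mul contDiff_invCutoff_norm)).smul contDiff_id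

/-- Away from the cut-off, `shellCompress y = (1/3 + 2 / (3‖y‖)) • y`. [folklore] -/
theorem shellCompress_eq {y : 𝔼 4} (hy : 1 / 4 ≤ ‖y‖) :
    shellCompress y = (3⁻¹ + 2 / 3 * ‖y‖⁻¹) • y := by
  unfold shellCompress
  rw [invCutoff_eq_inv hy]

/-- `shellCompress (t • u) = ((t + 2) / 3) • u` for a unit vector `u` and `t ≥ 1/4`. [folklore] -/
theorem shellCompress_smul {u : 𝔼 4} (hu : ‖u‖ = 1) {t : ℝ} (ht : 1 / 4 ≤ t) :
    shellCompress (t • u) = ((t + 2) / 3) • u := by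
  have ht0 : t ≠ 0 := by positivity
  have hn : ‖t • u‖ = t := by rw [norm_smul, hu, mul_one, Real.norm_of_nonneg (by positivity)]
  rw [shellCompress_eq (by rw [hn]; exact ht), hn, smul_smul]
  congr 1
  field_simp

/-- `‖shellCompress y‖ = (‖y‖ + 2) / 3` away from the cut-off. [folklore] -/
theorem norm_shellCompress {y : 𝔼 4} (hy : 1 / 4 ≤ ‖y‖) :
    ‖shellCompress y‖ = (‖y‖ + 2) / 3 := by
  have hy0 : 0 < ‖y‖ := by linarith
  have hc : 0 ≤ 3⁻¹ + 2 / 3 * ‖y‖⁻¹ := by positivity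
  rw [shellCompress_eq hy, norm_smul, Real.norm_of_nonneg hc]
  field_simp

/-- The **radial expansion** `z ↦ (3 - 2 / ‖z‖) • z` (`r • u ↦ (3 r - 2) • u`), the inverse of
`shellCompress` on `{‖y‖ ≥ 1/4}` (cut off near the origin). [folklore] -/
def shellExpand (z : 𝔼 4) : 𝔼 4 :=
  (3 - 2 * invCutoff ‖z‖) • z

/-- `shellExpand` is `C^∞` on `ℝ⁴`. [folklore] -/
theorem contDiff_shellExpand : ContDiff ℝ ∞ shellExpand :=
  (contDiff_const.sub (contDiff_const.mul contDiff_invCutoff_norm)).smul contDiff_id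

/-- Away from the cut-off, `shellExpand z = (3 - 2 / ‖z‖) • z`. [folklore] -/
theorem shellExpand_eq {z : 𝔼 4} (hz : 1 / 4 ≤ ‖z‖) : shellExpand z = (3 - 2 * ‖z‖⁻¹) • z := by
  unfold shellExpand
  rw [invCutoff_eq_inv hz]

/-- `shellExpand` is a left inverse of `shellCompress` on `{‖y‖ ≥ 1/4}`. [folklore] -/
theorem shellExpand_shellCompress {y : 𝔼 4} (hy : 1 / 4 ≤ ‖y‖) :
    shellExpand (shellCompress y) = y := by
  have hy0 : 0 < ‖y‖ := by linarith
  have h1 : 1 / 4 ≤ ‖shellCompress y‖ := by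
    rw [norm_shellCompress hy]
    linarith
  have h2 : ‖y‖ + 2 ≠ 0 := by linarith
  rw [shellExpand_eq h1, norm_shellCompress hy, shellCompress_eq hy, smul_smul]
  conv_rhs => rw [← one_smul ℝ y]
  congr 1
  field_simp
  ring

/-- `shellCompress` is injective on `{‖y‖ ≥ 1/4}`. [folklore] -/
theorem shellCompress_injOn : InjOn shellCompress {y : 𝔼 4 | 1 / 4 ≤ ‖y‖} := by
  intro y hy y' hy' h
  rw [← shellExpand_shellCompress (y := y) hy, ← shellExpand_shellCompress (y := y') hy', h]

/-- The derivative of `shellCompress` at a point with `‖y‖ > 1/4` is injective (chain rule applied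
to `shellExpand ∘ shellCompress = id` near `y`). [folklore] -/
theorem fderiv_shellCompress_injective {y : 𝔼 4} (hy : 1 / 4 < ‖y‖) :
    Injective (fderiv ℝ shellCompress y) := by
  have hev : shellExpand ∘ shellCompress =ᶠ[𝓝 y] id := by
    have hU : {z : 𝔼 4 | 1 / 4 < ‖z‖} ∈ 𝓝 y :=
      (isOpen_lt continuous_const continuous_norm).mem_nhds hy
    filter_upwards [hU] with z hz using shellExpand_shellCompress (le_of_lt hz)
  have hd : DifferentiableAt ℝ shellCompress y :=
    contDiff_shellCompress.contDiffAt.differentiableAt (by simp)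
  have hd' : DifferentiableAt ℝ shellExpand (shellCompress y) :=
    contDiff_shellExpand.contDiffAt.differentiableAt (by simp)
  have key : (fderiv ℝ shellExpand (shellCompress y)).comp (fderiv ℝ shellCompress y) =
      ContinuousLinearMap.id ℝ (𝔼 4) := by
    rw [← fderiv_comp y hd' hd, hev.fderiv_eq, fderiv_id]
  intro v w h
  have h' := congrArg (fderiv ℝ shellExpand (shellCompress y)) h
  rwa [← ContinuousLinearMap.comp_apply, ← ContinuousLinearMap.comp_apply, key] at h'

/-! ### Affine changes of the time parameter -/

/-- **Halving the time**: `(x, t) ↦ (x, t / 2)`. [folklore] -/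
def half (p : (𝕊 1) × ℝ) : (𝕊 1) × ℝ :=
  (p.1, p.2 / 2)

/-- **Tripling the time** (up to a shift): `(x, s) ↦ (x, 3 s - 2)`, carrying `[1, 2]` onto `[1, 4]`.
[folklore] -/
def triple (p : (𝕊 1) × ℝ) : (𝕊 1) × ℝ :=
  (p.1, 3 * p.2 - 2)

/-- Components of `half`. [folklore] -/
@[simp]
theorem half_apply (x : 𝕊 1) (t : ℝ) : half (x, t) = (x, t / 2) := rfl

/-- Components of `triple`. [folklore] -/
@[simp]
theorem triple_apply (x : 𝕊 1) (s : ℝ) : triple (x, s) = (x, 3 * s - 2) := rfl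

/-- `half` is `C^∞`. [folklore] -/
theorem contMDiff_half : ContMDiff ((𝓡 1).prod 𝓘(ℝ, ℝ)) ((𝓡 1).prod 𝓘(ℝ, ℝ)) ∞ half :=
  contMDiff_fst.prodMk ((contDiff_id.div_const (2 : ℝ)).contMDiff.comp contMDiff_snd)

/-- `triple` is `C^∞`. [folklore] -/
theorem contMDiff_triple : ContMDiff ((𝓡 1).prod 𝓘(ℝ, ℝ)) ((𝓡 1).prod 𝓘(ℝ, ℝ)) ∞ triple :=
  contMDiff_fst.prodMk
    ((((contDiff_const (c := (3 : ℝ))).mul contDiff_id).sub contDiff_const).contMDiff.comp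
      contMDiff_snd)

/-- A `C^∞` self-map of `𝕊 1 × ℝ` with a `C^∞` left inverse has injective differential. [folklore] -/
theorem mfderiv_injective_of_leftInverse {φ ψ : (𝕊 1) × ℝ → (𝕊 1) × ℝ}
    (hφ : ContMDiff ((𝓡 1).prod 𝓘(ℝ, ℝ)) ((𝓡 1).prod 𝓘(ℝ, ℝ)) ∞ φ)
    (hψ : ContMDiff ((𝓡 1).prod 𝓘(ℝ, ℝ)) ((𝓡 1).prod 𝓘(ℝ, ℝ)) ∞ ψ) (h : ψ ∘ φ = id)
    (p : (𝕊 1) × ℝ) :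
    Injective (mfderiv ((𝓡 1).prod 𝓘(ℝ, ℝ)) ((𝓡 1).prod 𝓘(ℝ, ℝ)) φ p) := by
  have hdφ : MDifferentiableAt ((𝓡 1).prod 𝓘(ℝ, ℝ)) ((𝓡 1).prod 𝓘(ℝ, ℝ)) φ p :=
    hφ.mdifferentiableAt (by simp)
  have hdψ : MDifferentiableAt ((𝓡 1).prod 𝓘(ℝ, ℝ)) ((𝓡 1).prod 𝓘(ℝ, ℝ)) ψ (φ p) :=
    hψ.mdifferentiableAt (by simp)
  have key := mfderiv_comp p hdψ hdφ
  rw [h, mfderiv_id] at key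
  intro v w hvw
  have h' := congrArg (mfderiv ((𝓡 1).prod 𝓘(ℝ, ℝ)) ((𝓡 1).prod 𝓘(ℝ, ℝ)) ψ (φ p)) hvw
  rwa [← ContinuousLinearMap.comp_apply, ← ContinuousLinearMap.comp_apply, ← key] at h'

/-- The differential of `half` is injective. [folklore] -/
theorem mfderiv_half_injective (p : (𝕊 1) × ℝ) :
    Injective (mfderiv ((𝓡 1).prod 𝓘(ℝ, ℝ)) ((𝓡 1).prod 𝓘(ℝ, ℝ)) half p) := by
  refine mfderiv_injective_of_leftInverse contMDiff_half
    (ψ := fun q ↦ (q.1, 2 * q.2))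
    (contMDiff_fst.prodMk (((contDiff_const (c := (2 : ℝ))).mul contDiff_id).contMDiff.comp
      contMDiff_snd)) ?_ p
  funext q
  obtain ⟨x, t⟩ := q
  simp only [comp_apply, half_apply, id_eq, Prod.mk.injEq, true_and]
  ring

/-- The differential of `triple` is injective. [folklore] -/
theorem mfderiv_triple_injective (p : (𝕊 1) × ℝ) :
    Injective (mfderiv ((𝓡 1).prod 𝓘(ℝ, ℝ)) ((𝓡 1).prod 𝓘(ℝ, ℝ)) triple p) := by
  refine mfderiv_injective_of_leftInverse contMDiff_triple
    (ψ := fun q ↦ (q.1, (q.2 + 2) / 3))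
    (contMDiff_fst.prodMk (((contDiff_id.add contDiff_const).div_const (3 : ℝ)).contMDiff.comp
      contMDiff_snd)) ?_ p
  funext q
  obtain ⟨x, s⟩ := q
  simp only [comp_apply, triple_apply, id_eq, Prod.mk.injEq, true_and]
  ring

/-! ### Stacking two concordances which are cones at the seam -/

/-- The **stacked annulus** of `F` (on radii `[1, 2]`) and of `G` doubled (on radii `[2, 4]`):
`(x, r) ↦ F (x, r)` for `r ≤ 2` and `(x, r) ↦ 2 • G (x, r / 2)` for `r > 2`. When `F` is a
concordance from `K` to `K'` which is the cone `t • K'` near its outer end and `G` a concordance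
from `K'` to `K''` which is the cone `t • K'` near its inner end, the two pieces agree with the cone
`r • K'` on a strip around the seam `r = 2`, so the stacked annulus is a smooth neat annulus from
`K` (radius `1`) to `4 • K''` (radius `4`) in the doubled shell `1 ≤ ‖y‖ ≤ 4`
(Fox–Milnor (1966), §1: knot cobordism is transitive by stacking). [cite: FoxMilnor1966, §1] -/
def stack (F G : (𝕊 1) × ℝ → 𝔼 4) (p : (𝕊 1) × ℝ) : 𝔼 4 :=
  if p.2 ≤ 2 then F p else (2 : ℝ) • G (half p)

/-- The **composite concordance**: the stacked annulus re-timed by `triple` (`[1, 2] → [1, 4]`)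
and compressed by `shellCompress` (radii `[1, 4] → [1, 2]`). [cite: FoxMilnor1966, §1] -/
def compose (F G : (𝕊 1) × ℝ → 𝔼 4) : (𝕊 1) × ℝ → 𝔼 4 :=
  shellCompress ∘ (stack F G ∘ triple)

section Stack

variable {K K' K'' : Knot} {F G : (𝕊 1) × ℝ → 𝔼 4} {δ : ℝ}

/-- Below the seam the stacked annulus is `F`. [folklore] -/
theorem stack_of_le_two {x : 𝕊 1} {r : ℝ} (hr : r ≤ 2) : stack F G (x, r) = F (x, r) :=
  if_pos hr

/-- Above the seam the stacked annulus is `2 • G (x, r / 2)`. [folklore] -/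
theorem stack_of_two_lt {x : 𝕊 1} {r : ℝ} (hr : 2 < r) :
    stack F G (x, r) = (2 : ℝ) • G (x, r / 2) :=
  if_neg (not_le.2 hr)

/-- Around the seam the stacked annulus is the cone `r • K' x`. [folklore] -/
theorem stack_eq_cone
    (hFc : ∀ x : 𝕊 1, ∀ t ∈ Icc (2 - δ) 2, F (x, t) = t • ((K' x : 𝕊 3) : 𝔼 4))
    (hGc : ∀ x : 𝕊 1, ∀ t ∈ Icc (1 : ℝ) (1 + δ), G (x, t) = t • ((K' x : 𝕊 3) : 𝔼 4))
    (x : 𝕊 1) {r : ℝ} (hr : |r - 2| ≤ δ) : stack F G (x, r) = r • ((K' x : 𝕊 3) : 𝔼 4) := by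
  obtain ⟨h1, h2⟩ := abs_le.1 hr
  rcases le_or_gt r 2 with h | h
  · rw [stack_of_le_two h, hFc x r ⟨by linarith, h⟩]
  · rw [stack_of_two_lt h, hGc x (r / 2) ⟨by linarith, by linarith⟩, smul_smul]
    congr 1
    ring

/-- Above the seam (inclusive) the stacked annulus is `2 • G (x, r / 2)`, provided `G` starts at
`K'` and `F` ends at `2 • K'`. [folklore] -/
theorem stack_of_two_le (hF : IsConcordance K K' F) (hG : IsConcordance K' K'' G) {x : 𝕊 1}
    {r : ℝ} (hr : 2 ≤ r) : stack F G (x, r) = (2 : ℝ) • G (x, r / 2) := by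
  rcases eq_or_lt_of_le hr with h | h
  · subst h
    rw [stack_of_le_two le_rfl, hF.2.2.2.2.2.2 x, show (2 : ℝ) / 2 = 1 by norm_num, hG.2.2.2.2.2.1 x]
  · exact stack_of_two_lt h

/-- The stacked annulus is `C^∞` (it is `F`, the cone `r • K'`, resp. `2 • G ∘ half` on the open
cover `{r < 2}`, `{|r - 2| < δ}`, `{r > 2}`). [folklore] -/
theorem contMDiff_stack (hF : IsConcordance K K' F) (hG : IsConcordance K' K'' G) (hδ : 0 < δ)
    (hFc : ∀ x : 𝕊 1, ∀ t ∈ Icc (2 - δ) 2, F (x, t) = t • ((K' x : 𝕊 3) : 𝔼 4))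
    (hGc : ∀ x : 𝕊 1, ∀ t ∈ Icc (1 : ℝ) (1 + δ), G (x, t) = t • ((K' x : 𝕊 3) : 𝔼 4)) :
    ContMDiff ((𝓡 1).prod 𝓘(ℝ, ℝ)) 𝓘(ℝ, 𝔼 4) ∞ (stack F G) := by
  rintro ⟨x, r⟩
  rcases lt_trichotomy r 2 with h | h | h
  · have hev : stack F G =ᶠ[𝓝 (x, r)] F := by
      have hO : IsOpen {q : (𝕊 1) × ℝ | q.2 < 2} := isOpen_lt continuous_snd continuous_const
      filter_upwards [hO.mem_nhds h] with q hq
      obtain ⟨y, s⟩ := q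
      exact stack_of_le_two (le_of_lt hq)
    exact (hF.1 (x, r)).congr_of_eventuallyEq hev
  · subst h
    have hev : stack F G =ᶠ[𝓝 (x, (2 : ℝ))] coneMap fun p : (𝕊 1) × ℝ ↦ K' p.1 := by
      have hO : IsOpen {q : (𝕊 1) × ℝ | |q.2 - 2| < δ} :=
        isOpen_lt (continuous_abs.comp (continuous_snd.sub continuous_const)) continuous_const
      filter_upwards [hO.mem_nhds (show |(2 : ℝ) - 2| < δ by simpa using hδ)] with q hq
      obtain ⟨y, s⟩ := q
      rw [stack_eq_cone hFc hGc y (le_of_lt hq), coneMap_apply]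
    exact (contMDiff_coneMap _ (K'.contMDiff.comp contMDiff_fst) (x, 2)).congr_of_eventuallyEq hev
  · have hev : stack F G =ᶠ[𝓝 (x, r)] fun q ↦ (2 : ℝ) • G (half q) := by
      have hO : IsOpen {q : (𝕊 1) × ℝ | 2 < q.2} := isOpen_lt continuous_const continuous_snd
      filter_upwards [hO.mem_nhds h] with q hq
      obtain ⟨y, s⟩ := q
      exact stack_of_two_lt hq
    have h2 : ContMDiff ((𝓡 1).prod 𝓘(ℝ, ℝ)) 𝓘(ℝ, ℝ) ∞ fun _ : (𝕊 1) × ℝ ↦ (2 : ℝ) :=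
      contMDiff_const
    have hsm : ContMDiff ((𝓡 1).prod 𝓘(ℝ, ℝ)) 𝓘(ℝ, 𝔼 4) ∞
        fun q : (𝕊 1) × ℝ ↦ (2 : ℝ) • G (half q) :=
      h2.smul (hG.1.comp contMDiff_half)
    exact (hsm (x, r)).congr_of_eventuallyEq hev

/-- Norm bounds for the stacked annulus on the closed doubled annulus `r ∈ [1, 4]`. [folklore] -/
theorem norm_stack_mem (hF : IsConcordance K K' F) (hG : IsConcordance K' K'' G) (x : 𝕊 1)
    {r : ℝ} (hr : r ∈ Icc (1 : ℝ) 4) : 1 ≤ ‖stack F G (x, r)‖ ∧ ‖stack F G (x, r)‖ ≤ 4 := by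
  rcases le_or_gt r 2 with h | h
  · rw [stack_of_le_two h]
    have := norm_mem_Icc hF x ⟨hr.1, h⟩
    exact ⟨this.1, by linarith [this.2]⟩
  · rw [stack_of_two_lt h, norm_smul, Real.norm_two]
    have := norm_mem_Icc hG x (t := r / 2) ⟨by linarith, by linarith [hr.2]⟩
    exact ⟨by linarith [this.1], by linarith [this.2]⟩

/-- Norm bounds for the stacked annulus on the open doubled annulus `r ∈ (1, 4)`. [folklore] -/
theorem norm_stack_Ioo (hF : IsConcordance K K' F) (hG : IsConcordance K' K'' G) (x : 𝕊 1)
    {r : ℝ} (hr : r ∈ Ioo (1 : ℝ) 4) : 1 < ‖stack F G (x, r)‖ ∧ ‖stack F G (x, r)‖ < 4 := by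
  rcases lt_trichotomy r 2 with h | h | h
  · rw [stack_of_le_two h.le]
    have := hF.2.2.2.1 x r ⟨hr.1, h⟩
    exact ⟨this.1, by linarith [this.2]⟩
  · subst h
    rw [stack_of_le_two le_rfl, hF.2.2.2.2.2.2 x, norm_smul, norm_eq_of_mem_sphere]
    norm_num
  · rw [stack_of_two_lt h, norm_smul, Real.norm_two]
    have := hG.2.2.2.1 x (r / 2) ⟨by linarith, by linarith [hr.2]⟩
    exact ⟨by linarith [this.1], by linarith [this.2]⟩

/-- The stacked annulus is injective on `𝕊 1 × [1, 4]` (the two pieces are separated by the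
sphere of radius `2`, which both meet only along `2 • K'` at the seam). [folklore] -/
theorem stack_injOn (hF : IsConcordance K K' F) (hG : IsConcordance K' K'' G) :
    InjOn (stack F G) (univ ×ˢ Icc (1 : ℝ) 4) := by
  have key : ∀ {x x' : 𝕊 1} {r r' : ℝ}, r ∈ Icc (1 : ℝ) 4 → r' ∈ Icc (1 : ℝ) 4 → r ≤ 2 → 2 < r' →
      stack F G (x, r) ≠ stack F G (x', r') := by
    intro x x' r r' hr hr' h h' heq
    have hn := congrArg norm heq
    rw [stack_of_le_two h, stack_of_two_lt h', norm_smul, Real.norm_two] at hn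
    have h1 := (norm_mem_Icc hF x ⟨hr.1, h⟩).2
    have h2 : 1 < ‖G (x', r' / 2)‖ := by
      rcases lt_or_ge (r' / 2) 2 with h3 | h3
      · exact (hG.2.2.2.1 x' (r' / 2) ⟨by linarith, h3⟩).1
      · have h4 : r' / 2 = 2 := le_antisymm (by linarith [hr'.2]) h3
        rw [h4, hG.2.2.2.2.2.2 x', norm_smul, norm_eq_of_mem_sphere]
        norm_num
    linarith
  rintro ⟨x, r⟩ ⟨-, hr⟩ ⟨x', r'⟩ ⟨-, hr'⟩ h
  rcases le_or_gt r 2 with h1 | h1 <;> rcases le_or_gt r' 2 with h2 | h2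
  · rw [stack_of_le_two h1, stack_of_le_two h2] at h
    exact hF.2.1 ⟨mem_univ _, ⟨hr.1, h1⟩⟩ ⟨mem_univ _, ⟨hr'.1, h2⟩⟩ h
  · exact absurd h (key hr hr' h1 h2)
  · exact absurd h.symm (key hr' hr h2 h1)
  · rw [stack_of_two_lt h1, stack_of_two_lt h2] at h
    have h' := smul_right_injective (𝔼 4) (two_ne_zero (α := ℝ)) h
    have := hG.2.1 ⟨mem_univ x, ⟨by linarith, by linarith [hr.2]⟩⟩
      ⟨mem_univ x', ⟨by linarith, by linarith [hr'.2]⟩⟩ h'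
    simp only [Prod.mk.injEq] at this
    obtain ⟨rfl, hrr⟩ := this
    simp only [Prod.mk.injEq, true_and]
    linarith

/-- The stacked annulus is an immersion on `𝕊 1 × [1, 4]`. [folklore] -/
theorem injective_mfderiv_stack (hF : IsConcordance K K' F) (hG : IsConcordance K' K'' G)
    (hδ : 0 < δ)
    (hFc : ∀ x : 𝕊 1, ∀ t ∈ Icc (2 - δ) 2, F (x, t) = t • ((K' x : 𝕊 3) : 𝔼 4))
    (hGc : ∀ x : 𝕊 1, ∀ t ∈ Icc (1 : ℝ) (1 + δ), G (x, t) = t • ((K' x : 𝕊 3) : 𝔼 4))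
    (x : 𝕊 1) {r : ℝ} (hr : r ∈ Icc (1 : ℝ) 4) :
    Injective (mfderiv ((𝓡 1).prod 𝓘(ℝ, ℝ)) 𝓘(ℝ, 𝔼 4) (stack F G) (x, r)) := by
  rcases lt_trichotomy r 2 with h | h | h
  · have hev : stack F G =ᶠ[𝓝 (x, r)] F := by
      have hO : IsOpen {q : (𝕊 1) × ℝ | q.2 < 2} := isOpen_lt continuous_snd continuous_const
      filter_upwards [hO.mem_nhds h] with q hq
      obtain ⟨y, s⟩ := q
      exact stack_of_le_two (le_of_lt hq)
    rw [hev.mfderiv_eq]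
    exact hF.2.2.1 (x, r) ⟨mem_univ _, ⟨hr.1, h.le⟩⟩
  · subst h
    have hev : stack F G =ᶠ[𝓝 (x, (2 : ℝ))] coneMap fun p : (𝕊 1) × ℝ ↦ K' p.1 := by
      have hO : IsOpen {q : (𝕊 1) × ℝ | |q.2 - 2| < δ} :=
        isOpen_lt (continuous_abs.comp (continuous_snd.sub continuous_const)) continuous_const
      filter_upwards [hO.mem_nhds (show |(2 : ℝ) - 2| < δ by simpa using hδ)] with q hq
      obtain ⟨y, s⟩ := q
      rw [stack_eq_cone hFc hGc y (le_of_lt hq), coneMap_apply]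
    rw [hev.mfderiv_eq]
    exact (isConcordance_coneMap_self K').2.2.1 (x, 2) ⟨mem_univ _, by norm_num⟩
  · have hev : stack F G =ᶠ[𝓝 (x, r)] ((2 : ℝ) • (G ∘ half)) := by
      have hO : IsOpen {q : (𝕊 1) × ℝ | 2 < q.2} := isOpen_lt continuous_const continuous_snd
      filter_upwards [hO.mem_nhds h] with q hq
      obtain ⟨y, s⟩ := q
      exact stack_of_two_lt hq
    rw [hev.mfderiv_eq]
    have hdh : MDifferentiableAt ((𝓡 1).prod 𝓘(ℝ, ℝ)) ((𝓡 1).prod 𝓘(ℝ, ℝ)) half (x, r) :=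
      contMDiff_half.mdifferentiableAt (by simp)
    have hdG : MDifferentiableAt ((𝓡 1).prod 𝓘(ℝ, ℝ)) 𝓘(ℝ, 𝔼 4) G (half (x, r)) :=
      hG.1.mdifferentiableAt (by simp)
    rw [const_smul_mfderiv (hdG.comp _ hdh), mfderiv_comp _ hdG hdh]
    have hinj : Injective ((mfderiv ((𝓡 1).prod 𝓘(ℝ, ℝ)) 𝓘(ℝ, 𝔼 4) G (half (x, r))).comp
        (mfderiv ((𝓡 1).prod 𝓘(ℝ, ℝ)) ((𝓡 1).prod 𝓘(ℝ, ℝ)) half (x, r))) :=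
      (hG.2.2.1 (half (x, r)) ⟨mem_univ _, ⟨by simp only [half_apply]; linarith,
        by simp only [half_apply]; linarith [hr.2]⟩⟩).comp (mfderiv_half_injective _)
    intro v w hvw
    apply hinj
    have hvw' : (2 : ℝ) • ((mfderiv ((𝓡 1).prod 𝓘(ℝ, ℝ)) 𝓘(ℝ, 𝔼 4) G (half (x, r))).comp
        (mfderiv ((𝓡 1).prod 𝓘(ℝ, ℝ)) ((𝓡 1).prod 𝓘(ℝ, ℝ)) half (x, r))) v =
        (2 : ℝ) • ((mfderiv ((𝓡 1).prod 𝓘(ℝ, ℝ)) 𝓘(ℝ, 𝔼 4) G (half (x, r))).comp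
        (mfderiv ((𝓡 1).prod 𝓘(ℝ, ℝ)) ((𝓡 1).prod 𝓘(ℝ, ℝ)) half (x, r))) w := hvw
    exact smul_right_injective _ (two_ne_zero (α := ℝ)) hvw'

/-- **The composite of two concordances is a concordance.** If `F` is a concordance from `K` to
`K'` which is the cone `t • K'` for `t ∈ [2 - δ, 2]` and `G` a concordance from `K'` to `K''` which
is the cone `t • K'` for `t ∈ [1, 1 + δ]`, then `compose F G` is a concordance from `K` to `K''`.
Fox–Milnor (1966), §1 (transitivity of knot cobordism); Livingston (2005), Thm. 2.1.
[cite: FoxMilnor1966, §1] -/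
theorem isConcordance_compose (hF : IsConcordance K K' F) (hG : IsConcordance K' K'' G)
    (hδ : 0 < δ)
    (hFc : ∀ x : 𝕊 1, ∀ t ∈ Icc (2 - δ) 2, F (x, t) = t • ((K' x : 𝕊 3) : 𝔼 4))
    (hGc : ∀ x : 𝕊 1, ∀ t ∈ Icc (1 : ℝ) (1 + δ), G (x, t) = t • ((K' x : 𝕊 3) : 𝔼 4)) :
    IsConcordance K K'' (compose F G) := by
  have hS := contMDiff_stack hF hG hδ hFc hGc
  have htriple_mem : ∀ {s : ℝ}, s ∈ Icc (1 : ℝ) 2 → 3 * s - 2 ∈ Icc (1 : ℝ) 4 := fun hs ↦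
    ⟨by linarith [hs.1], by linarith [hs.2]⟩
  have hquarter : ∀ (x : 𝕊 1) {s : ℝ}, s ∈ Icc (1 : ℝ) 2 → 1 / 4 ≤ ‖stack F G (x, 3 * s - 2)‖ :=
    fun x s hs ↦ by linarith [(norm_stack_mem hF hG x (htriple_mem hs)).1]
  refine ⟨?_, ?_, ?_, ?_, ?_, ?_, ?_⟩
  · -- smoothness
    exact contDiff_shellCompress.contMDiff.comp (hS.comp contMDiff_triple)
  · -- injectivity on the annulus
    rintro ⟨x, s⟩ ⟨-, hs⟩ ⟨x', s'⟩ ⟨-, hs'⟩ h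
    have h1 := shellCompress_injOn (hquarter x hs) (hquarter x' hs') h
    have h2 := stack_injOn hF hG ⟨mem_univ x, htriple_mem hs⟩ ⟨mem_univ x', htriple_mem hs'⟩ h1
    simp only [Prod.mk.injEq] at h2
    obtain ⟨rfl, hss⟩ := h2
    simp only [Prod.mk.injEq, true_and]
    linarith
  · -- immersion on the annulus
    rintro ⟨x, s⟩ ⟨-, hs⟩
    have hdt : MDifferentiableAt ((𝓡 1).prod 𝓘(ℝ, ℝ)) ((𝓡 1).prod 𝓘(ℝ, ℝ)) triple (x, s) :=
      contMDiff_triple.mdifferentiableAt (by simp)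
    have hds : MDifferentiableAt ((𝓡 1).prod 𝓘(ℝ, ℝ)) 𝓘(ℝ, 𝔼 4) (stack F G) (triple (x, s)) :=
      hS.mdifferentiableAt (by simp)
    have hdC : MDifferentiableAt 𝓘(ℝ, 𝔼 4) 𝓘(ℝ, 𝔼 4) shellCompress ((stack F G ∘ triple) (x, s)) :=
      contDiff_shellCompress.contMDiff.mdifferentiableAt (by simp)
    rw [compose, mfderiv_comp _ hdC (hds.comp _ hdt), mfderiv_comp _ hds hdt, mfderiv_eq_fderiv]
    refine (fderiv_shellCompress_injective ?_).comp
      ((injective_mfderiv_stack hF hG hδ hFc hGc x (htriple_mem hs)).comp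
        (mfderiv_triple_injective _))
    have := hquarter x hs
    show 1 / 4 < ‖stack F G (x, 3 * s - 2)‖
    linarith [(norm_stack_mem hF hG x (htriple_mem hs)).1]
  · -- the open annulus goes into the open shell
    intro x s hs
    have hr : 3 * s - 2 ∈ Ioo (1 : ℝ) 4 := ⟨by linarith [hs.1], by linarith [hs.2]⟩
    obtain ⟨hl, hu⟩ := norm_stack_Ioo hF hG x hr
    show 1 < ‖shellCompress (stack F G (x, 3 * s - 2))‖ ∧ ‖shellCompress (stack F G (x, 3 * s - 2))‖ < 2
    rw [norm_shellCompress (by linarith)]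
    exact ⟨by linarith, by linarith⟩
  · -- neatness at both ends
    intro x
    -- the radial functions of `F` and `G` along the `t`-lines through `x`
    set hf : ℝ → ℝ := fun t ↦ ‖F (x, t)‖ ^ 2 with hf_def
    set hg : ℝ → ℝ := fun t ↦ ‖G (x, t)‖ ^ 2 with hg_def
    have hcF : Differentiable ℝ fun t : ℝ ↦ F (x, t) :=
      (contMDiff_iff_contDiff.1 (hF.1.comp (contMDiff_const.prodMk contMDiff_id))).differentiable
        (by simp)
    have hcG : Differentiable ℝ fun t : ℝ ↦ G (x, t) :=
      (contMDiff_iff_contDiff.1 (hG.1.comp (contMDiff_const.prodMk contMDiff_id))).differentiable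
        (by simp)
    have hdf : Differentiable ℝ hf := hcF.norm_sq ℝ
    have hdg : Differentiable ℝ hg := hcG.norm_sq ℝ
    have hsqf : ∀ t, Real.sqrt (hf t) = ‖F (x, t)‖ := fun t ↦ by
      simp only [hf_def]
      exact Real.sqrt_sq (norm_nonneg _)
    have hsqg : ∀ t, Real.sqrt (hg t) = ‖G (x, t)‖ := fun t ↦ by
      simp only [hg_def]
      exact Real.sqrt_sq (norm_nonneg _)
    have nF1 : ‖F (x, 1)‖ = 1 := by rw [hF.2.2.2.2.2.1 x, norm_eq_of_mem_sphere]
    have nG2 : ‖G (x, 2)‖ = 2 := by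
      rw [hG.2.2.2.2.2.2 x, norm_smul, norm_eq_of_mem_sphere]
      norm_num
    obtain ⟨hF1, -⟩ := hF.2.2.2.2.1 x
    obtain ⟨-, hG2⟩ := hG.2.2.2.2.1 x
    constructor
    · -- inner end: `‖compose F G (x, s)‖ = (‖F (x, 3 s - 2)‖ + 2) / 3` near `s = 1`
      have hev : (fun s ↦ ‖compose F G (x, s)‖ ^ 2) =ᶠ[𝓝 1]
          fun s ↦ ((Real.sqrt (hf (3 * s - 2)) + 2) / 3) ^ 2 := by
        have hc : ContinuousAt (fun s : ℝ ↦ ‖F (x, 3 * s - 2)‖) 1 :=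
          ((hcF.continuous.comp ((continuous_const.mul continuous_id).sub continuous_const)).norm
            ).continuousAt
        have e1 : ∀ᶠ s in 𝓝 (1 : ℝ), 1 / 2 < ‖F (x, 3 * s - 2)‖ :=
          hc.eventually (lt_mem_nhds (by norm_num [nF1]))
        have e2 : ∀ᶠ s in 𝓝 (1 : ℝ), s < 4 / 3 := gt_mem_nhds (by norm_num)
        filter_upwards [e1, e2] with s h1 h2
        show ‖shellCompress (stack F G (x, 3 * s - 2))‖ ^ 2 = _
        rw [stack_of_le_two (by linarith), norm_shellCompress (by linarith), hsqf]
      have hne : hf (3 * 1 - 2) ≠ 0 := by norm_num [hf_def, nF1]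
      have ha : HasDerivAt (fun s : ℝ ↦ 3 * s - 2) (3 * 1) 1 :=
        ((hasDerivAt_id (1 : ℝ)).const_mul 3).sub_const 2
      have hcomp : HasDerivAt (fun s ↦ hf (3 * s - 2)) (deriv hf (3 * 1 - 2) * (3 * 1)) 1 :=
        (hdf _).hasDerivAt.comp 1 ha
      have hd := ((((hcomp.sqrt hne).add_const 2).div_const 3).pow 2).congr_of_eventuallyEq hev
      rw [hd.deriv, show (3 : ℝ) * 1 - 2 = 1 by norm_num, hsqf, nF1]
      norm_num
      linarith
    · -- outer end: `‖compose F G (x, s)‖ = (2 ‖G (x, (3 s - 2) / 2)‖ + 2) / 3` near `s = 2`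
      have hev : (fun s ↦ ‖compose F G (x, s)‖ ^ 2) =ᶠ[𝓝 2]
          fun s ↦ ((2 * Real.sqrt (hg ((3 * s - 2) / 2)) + 2) / 3) ^ 2 := by
        have hc : ContinuousAt (fun s : ℝ ↦ ‖G (x, (3 * s - 2) / 2)‖) 2 :=
          ((hcG.continuous.comp (((continuous_const.mul continuous_id).sub
            continuous_const).div_const 2)).norm).continuousAt
        have e1 : ∀ᶠ s in 𝓝 (2 : ℝ), 1 / 2 < ‖G (x, (3 * s - 2) / 2)‖ :=
          hc.eventually (lt_mem_nhds (by norm_num [nG2]))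
        have e2 : ∀ᶠ s in 𝓝 (2 : ℝ), 4 / 3 < s := lt_mem_nhds (by norm_num)
        filter_upwards [e1, e2] with s h1 h2
        show ‖shellCompress (stack F G (x, 3 * s - 2))‖ ^ 2 = _
        rw [stack_of_two_lt (by linarith), norm_shellCompress
          (by rw [norm_smul, Real.norm_two]; linarith), norm_smul, Real.norm_two, hsqg]
      have hne : hg ((3 * 2 - 2) / 2) ≠ 0 := by norm_num [hg_def, nG2]
      have ha : HasDerivAt (fun s : ℝ ↦ (3 * s - 2) / 2) (3 * 1 / 2) 2 :=
        (((hasDerivAt_id (2 : ℝ)).const_mul 3).sub_const 2).div_const 2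
      have hcomp : HasDerivAt (fun s ↦ hg ((3 * s - 2) / 2))
          (deriv hg ((3 * 2 - 2) / 2) * (3 * 1 / 2)) 2 :=
        (hdg _).hasDerivAt.comp 2 ha
      have hd := (((((hcomp.sqrt hne).const_mul 2).add_const 2).div_const 3).pow 2
        ).congr_of_eventuallyEq hev
      rw [hd.deriv, show ((3 : ℝ) * 2 - 2) / 2 = 2 by norm_num, hsqg, nG2]
      norm_num
      linarith
  · -- `compose F G (x, 1) = K x`
    intro x
    show shellCompress (stack F G (x, 3 * 1 - 2)) = _
    rw [show (3 : ℝ) * 1 - 2 = 1 by norm_num, stack_of_le_two (by norm_num), hF.2.2.2.2.2.1 x,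
      ← one_smul ℝ ((K x : 𝕊 3) : 𝔼 4), shellCompress_smul (norm_eq_of_mem_sphere (K x)) (by norm_num)]
    norm_num
  · -- `compose F G (x, 2) = 2 • K'' x`
    intro x
    show shellCompress (stack F G (x, 3 * 2 - 2)) = _
    rw [show (3 : ℝ) * 2 - 2 = 4 by norm_num, stack_of_two_lt (by norm_num),
      show (4 : ℝ) / 2 = 2 by norm_num, hG.2.2.2.2.2.2 x, smul_smul,
      shellCompress_smul (norm_eq_of_mem_sphere (K'' x)) (by norm_num)]
    norm_num

end Stack

end IsConcordance

/-! ### Transitivity and the equivalence relation -/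

/-- **Concordance is transitive**, unconditionally: straighten the first concordance near its
outer end and the second near its inner end (Kosinski 1993, II (2.8.2)), stack, re-time and
compress (`IsConcordance.isConcordance_compose`). Fox–Milnor (1966), §1; Livingston (2005),
Thm. 2.1 (the version `IsConcordant.trans` of `SliceRibbon.lean` takes the named fact
`equivalence_isConcordant` as a hypothesis). [cite: FoxMilnor1966, §1] -/
theorem IsConcordant.trans' {K K' K'' : Knot} (h : K.IsConcordant K') (h' : K'.IsConcordant K'') :
    K.IsConcordant K'' := by
  obtain ⟨F₀, hF₀⟩ := h
  obtain ⟨G₀, hG₀⟩ := h'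
  obtain ⟨F, hF, δ₁, hδ₁, -, hFc⟩ := hF₀.exists_isConcordance_radial_outer
  obtain ⟨G, hG, δ₂, hδ₂, hGc⟩ := Straightening.exists_isConcordance_radial hG₀
  refine ⟨IsConcordance.compose F G, IsConcordance.isConcordance_compose (δ := min δ₁ δ₂) hF hG
    (lt_min hδ₁ hδ₂) (fun x t ht ↦ hFc x t ⟨?_, ht.2⟩) (fun x t ht ↦ hGc x t ⟨ht.1, ?_⟩)⟩
  · linarith [ht.1, min_le_left δ₁ δ₂]
  · linarith [ht.2, min_le_right δ₁ δ₂]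

end Knot

/-- **Concordance of knots is an equivalence relation** — discharge of the named fact
`Literature.Topology.FourManifolds.equivalence_isConcordant` (`SliceRibbon.lean`): reflexivity by
the radial annulus (`Knot.IsConcordant.refl'`, `SliceRibbonConcordanceProofs.lean`), symmetry by
reversing (`Knot.IsConcordant.swap`, `SliceGenusConcordance.lean`), transitivity by stacking
(`Knot.IsConcordant.trans'`). Fox–Milnor (1966), §1; Livingston (2005), Thm. 2.1.
[cite: FoxMilnor1966, §1] -/
theorem equivalence_isConcordant_holds : equivalence_isConcordant :=
  ⟨Knot.IsConcordant.refl', fun h ↦ h.swap, fun h h' ↦ h.trans' h'⟩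

end Literature.Topology.FourManifolds
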